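import Summits.Ventures.QEC.Census.CNFEncode
import HarnessLib

/-!
# List form of `cnfEncodeAny` for leaves with MANY appended unit clauses (CDX, qec-cdx-eng-1)

`cnfEncodeAny n rows us w ++ ⟨units.toArray⟩` makes the kernel append hundreds of clauses to a ~2·10⁴-clause `Array` one by one
(budget-1 fibre leaves pin ≈ 650 null coordinates), which exhausts the farm's per-check memory.  `cnfEncodeAnyList` is the SAME
clause list before `toArray` (definitionally: `cnfEncodeAny_eq_list`), so a leaf can be stated as
`⟨(cnfEncodeAnyList n rows us w ++ units).toArray⟩` (one list append) and transported to the `++` form expected by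
`cnfEncodeAny_append_unsat_imp` with `unsat_append_of_unsat_list`.
-/

namespace Summit.Ventures.QEC.CircuitDistance

open Std.Sat Summit.Ventures.QEC.Census.CNFEncode

/-- The clause LIST of `cnfEncodeAny` (same blocks, same order). -/
def cnfEncodeAnyList (n : ℕ) (rows : List (List ℕ)) (us : List (List ℕ)) (w : ℕ) : List (CNF.Clause Nat) :=
  let r1 := encRows n rows
  let r2 := encLogicals r1.2 us
  r1.1 ++ r2.1 ++ [r2.2.2.map fun t => (t, true)] ++ atMost n w r2.2.1

/-- `cnfEncodeAny` is its clause list as an array (definitional). -/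
theorem cnfEncodeAny_eq_list (n : ℕ) (rows : List (List ℕ)) (us : List (List ℕ)) (w : ℕ) :
    cnfEncodeAny n rows us w = ⟨(cnfEncodeAnyList n rows us w).toArray⟩ := rfl

/-- Transport of unsatisfiability from the one-list form to the `++` form. -/
theorem unsat_append_of_unsat_list {n : ℕ} {rows us : List (List ℕ)} {w : ℕ} (extra : List (CNF.Clause Nat))
    (h : (⟨(cnfEncodeAnyList n rows us w ++ extra).toArray⟩ : CNF Nat).Unsat) :
    ((cnfEncodeAny n rows us w) ++ (⟨extra.toArray⟩ : CNF Nat)).Unsat := by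
  intro a
  have := h a
  rw [cnfEncodeAny_eq_list]
  simp only [CNF.eval, CNF.Internal.clauses_append, List.all_toArray, Array.all_append] at this ⊢
  simpa [List.all_append] using this

end Summit.Ventures.QEC.CircuitDistance
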